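import Summits.BirchSwinnertonDyer.BirchSwinnertonDyer.Theorems.GenusKolyvaginAtTwoPowDvdShaCardAtTwoRTLadderCountTwin
import Literature.NumberTheory.EllipticCurves.IrreducibleModPQuadraticTwistProofs
import Literature.NumberTheory.EllipticCurves.VariableChangePointsMap
import Literature.NumberTheory.EllipticCurves.BinaryQuarticStabilizerTorsion
import Summits.BirchSwinnertonDyer.BirchSwinnertonDyer.Theorems.ByReductionTypeAtTwoTowerKerTwoTorsion
import Mathlib.GroupTheory.Torsion
import HarnessLib

/-!
# Route `GenusKolyvaginAtTwo`, LINE 18 / LINE 19 (L_T stmt-BirchSwinnertonDyer-23242, L⁺_T stmt-23379), stub 3a‴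
# `stub_twinLadderGenus` — bookkeeping between the ABSTRACT LADDER COUNT and the frame (1/2): losses bounded by an index,
# transfer of an index to `p`-primary components, and twist-invariance of local `2`-torsion counts

Seat `bsd-line-gk2-p3` g18 (cell `bsd-f1-sign2`), `--supports stmt-BirchSwinnertonDyer-23242` (helper; closes nothing).
THEOREMS ONLY (no definition, no named fact, no `sorry`); BSD is not proved by any of this.

* §1 `two_mul_sum_le_padicValNat_add_of_ladder_of_dvd_mul` (+ `_of_even`): the one-sided count of `…RTLadderCountTwin` with
  the loss hypothesis in the shape the `Ш`-level budget delivers — `#A ∣ k · g` with `0 < k ≤ p^β` (an INDEX bound, `k` not a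
  priori a power of `p`): `2 Σ e m ≤ v_p g + β`, and `+ 2⌊β/2⌋` when `v_p g` is even.
* §2 `exists_natCard_primaryComponent_eq_mul_of_le`: for subgroups `H ≤ R` of an abelian group with `[R : H] ≠ 0` and `H[p^∞]`
  finite, `#R[p^∞] = k · #H[p^∞]` with `0 < k ∣ [R : H]` — the passage from `[res⁻¹(Ш(E_K)) : Ш(E/ℚ)] ≤ 2^B`
  (`…RTRelaxedShaGenusBudget`) to the `2`-primary groups in which the count runs.
* §3 `ncard_isRoot_twoTorsionPolynomial_quadraticTwist`, `natCard_twoTorsion_quadraticTwist`,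
  `natCard_twoTorsion_baseChange_twin_eq`: over any field `L ⊇ ℚ`, a model `Wd = Cd • W^{(d)}` of a quadratic twist has as
  many `L`-rational `2`-torsion points as `W` (roots of `ψ_{W^{(d)}}(x) = d³ ψ_W(x/d)`; the variable change is a group
  isomorphism `VariableChange.pointEquivBaseChange`, counts transported by the tree's `TowerLayer.natCard_twoTorsion_congr`) — so the genus budget `∏_{q ∣ d_K} #Wd(ℚ_q)[2]` of the TWIN side equals
  `∏ #W(ℚ_q)[2] = 2^{ord₂ C(Wd)}`.

References: [McCallumLMS1991] §5; [Kramer1981] §2 Prop. 3; [SilvermanAEC2009] III.1 Table 3.1, III.2.3(d), X.§5.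
-/

set_option autoImplicit false
-- the Theorems namespace of this sub repeats the summit name by design (D-0017 nested layout)
set_option linter.dupNamespace false

noncomputable section

open scoped Classical

namespace Summit.BirchSwinnertonDyer.BirchSwinnertonDyer.Theorems.GenusExact.PlusDescent

open WeierstrassCurve Polynomial

universe u

/-! ## §1 The one-sided count with an index-shaped loss -/

section IndexLoss

variable {A : Type u} [AddCommGroup A]

/-- **One-sided ladder count, loss bounded by an index.**  If for every `m < T` the group `A` carries an independent family of
`2m+2` elements of order `p^{e m}`, and `#A ∣ k · g` with `0 < g`, `0 < k ≤ p^β` (e.g. `A = R[p^∞]`, `g = #H[p^∞]`, `k ∣ [R : H] ≤ p^β`),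
then `2 Σ_{m<T} e m ≤ v_p g + β` (`v_p k ≤ β` because `p^{v_p k} ∣ k ≤ p^β`). [cite: McCallumLMS1991, §5 (p. 310)] -/
theorem two_mul_sum_le_padicValNat_add_of_ladder_of_dvd_mul {p : ℕ} [hp : Fact p.Prime] (T : ℕ) (e : ℕ → ℕ)
    {g k β : ℕ} (hg : 0 < g) (hk : 0 < k) (hkβ : k ≤ p ^ β) (hA : Nat.card A ∣ k * g)
    (hfam : ∀ m < T, ∃ x : Fin (2 * m + 2) → A, (∀ i, addOrderOf (x i) = p ^ e m) ∧
      ∀ c : Fin (2 * m + 2) → ℤ, ∑ i, c i • x i = 0 → ∀ i, ((p ^ e m : ℕ) : ℤ) ∣ c i) :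
    2 * ∑ m ∈ Finset.range T, e m ≤ padicValNat p g + β := by
  have hp' := hp.out
  have hne : k * g ≠ 0 := mul_ne_zero hk.ne' hg.ne'
  haveI : Finite A := Nat.finite_of_card_ne_zero (fun h => hne (Nat.eq_zero_of_zero_dvd (h ▸ hA)))
  have h := (pow_two_mul_sum_dvd_natCard_of_ladder hp' T e hfam).trans hA
  have hle := (padicValNat_dvd_iff_le hne).mp h
  rw [padicValNat.mul hk.ne' hg.ne'] at hle
  have hvk : padicValNat p k ≤ β := by
    have h1 : p ^ padicValNat p k ≤ k := Nat.le_of_dvd hk pow_padicValNat_dvd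
    exact (Nat.pow_le_pow_iff_right hp'.one_lt).mp (h1.trans hkβ)
  omega

/-- **Parity refund with an index-shaped loss**: if moreover `v_p g` is even then `2 Σ e m ≤ v_p g + 2⌊β/2⌋`.
[cite: McCallumLMS1991, §5 (p. 310)] -/
theorem two_mul_sum_le_padicValNat_add_of_ladder_of_dvd_mul_of_even {p : ℕ} [hp : Fact p.Prime] (T : ℕ)
    (e : ℕ → ℕ) {g k β : ℕ} (hg : 0 < g) (hk : 0 < k) (hkβ : k ≤ p ^ β) (hA : Nat.card A ∣ k * g)
    (heven : Even (padicValNat p g))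
    (hfam : ∀ m < T, ∃ x : Fin (2 * m + 2) → A, (∀ i, addOrderOf (x i) = p ^ e m) ∧
      ∀ c : Fin (2 * m + 2) → ℤ, ∑ i, c i • x i = 0 → ∀ i, ((p ^ e m : ℕ) : ℤ) ∣ c i) :
    2 * ∑ m ∈ Finset.range T, e m ≤ padicValNat p g + 2 * (β / 2) := by
  have h := two_mul_sum_le_padicValNat_add_of_ladder_of_dvd_mul T e hg hk hkβ hA hfam
  obtain ⟨v, hv⟩ := heven
  omega

/-- `IsSquare n`, `n ≠ 0` ⟹ `v_p n` is even (the form in which Cassels–Tate squareness, tree theorem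
`GenusExact.CasselsTateNumberField.isSquare_natCard_primaryComponent_sha`, feeds the parity refund). [folklore] -/
theorem even_padicValNat_of_isSquare {p : ℕ} [hp : Fact p.Prime] {n : ℕ} (hn : n ≠ 0) (hsq : IsSquare n) :
    Even (padicValNat p n) := by
  obtain ⟨r, rfl⟩ := hsq
  have hr : r ≠ 0 := fun h => hn (by rw [h, mul_zero])
  rw [padicValNat.mul hr hr]
  exact ⟨_, rfl⟩

end IndexLoss

/-! ## §2 Transfer of an index to `p`-primary components -/

section Primary

variable {G : Type u} [AddCommGroup G]

/-- **`#R[p^∞] = k · #H[p^∞]` with `0 < k ∣ [R : H]`** for subgroups `H ≤ R` with `[R : H] ≠ 0` and `H[p^∞]` finite: the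
inclusion `H[p^∞] ↪ R[p^∞]` has cokernel embedding into `R/H` (an element of `R[p^∞]` that lies in `H` has `p`-power order in
`H`).  Applied to `Ш(E/ℚ) ≤ res⁻¹(Ш(E_K/K))` it turns the `Ш`-level genus budget into the loss hypothesis of §1. [folklore] -/
theorem exists_natCard_primaryComponent_eq_mul_of_le {H R : AddSubgroup G} (hHR : H ≤ R) (p : ℕ) [Fact p.Prime]
    (hidx : H.relIndex R ≠ 0) [Finite (AddCommGroup.primaryComponent H p)] :
    ∃ k : ℕ, 0 < k ∧ k ∣ H.relIndex R ∧
      Nat.card (AddCommGroup.primaryComponent R p) = k * Nat.card (AddCommGroup.primaryComponent H p) := by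
  set PH := AddCommGroup.primaryComponent H p with hPH
  set PR := AddCommGroup.primaryComponent R p with hPR
  let ι : H →+ R := AddSubgroup.inclusion hHR
  have hι : Function.Injective ι := AddSubgroup.inclusion_injective hHR
  -- `ι(H[p^∞]) ≤ R[p^∞]`
  set Q : AddSubgroup R := PH.map ι with hQ
  have hQle : Q ≤ PR := by
    rintro _ ⟨x, hx, rfl⟩
    obtain ⟨n, hn⟩ := (AddCommGroup.mem_primaryComponent).mp hx
    exact (AddCommGroup.mem_primaryComponent).mpr ⟨n, by rw [← map_nsmul, hn, map_zero]⟩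
  have hQcard : Nat.card Q = Nat.card PH := AddSubgroup.card_map_of_injective hι
  -- the quotient map `R → R/H` restricted to `R[p^∞]`
  haveI : Finite (R ⧸ H.addSubgroupOf R) := by
    have : (H.addSubgroupOf R).index ≠ 0 := hidx
    exact (AddSubgroup.fintypeOfIndexNeZero this).finite
  let φ : PR →+ R ⧸ H.addSubgroupOf R := (QuotientAddGroup.mk' (H.addSubgroupOf R)).comp PR.subtype
  have hker : φ.ker = Q.addSubgroupOf PR := by
    ext x
    rw [AddMonoidHom.mem_ker, AddSubgroup.mem_addSubgroupOf, AddMonoidHom.comp_apply, AddSubgroup.coe_subtype,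
      QuotientAddGroup.mk'_apply, QuotientAddGroup.eq_zero_iff, AddSubgroup.mem_addSubgroupOf]
    constructor
    · intro hxH
      -- `(x : R) : G` lies in `H`, with `p`-power order
      obtain ⟨n, hn⟩ := (AddCommGroup.mem_primaryComponent).mp x.2
      refine ⟨⟨((x : R) : G), hxH⟩, ?_, ?_⟩
      · refine (AddCommGroup.mem_primaryComponent).mpr ⟨n, ?_⟩
        apply Subtype.ext
        have h' := congrArg (fun y : R => (y : G)) hn
        simpa using h'
      · exact Subtype.ext rfl
    · rintro ⟨y, -, hy⟩
      rw [← hy]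
      exact y.2
  have hkercard : Nat.card φ.ker = Nat.card PH := by
    rw [hker, Nat.card_congr (AddSubgroup.addSubgroupOfEquivOfLe hQle).toEquiv, hQcard]
  refine ⟨Nat.card φ.range, Nat.card_pos, ?_, ?_⟩
  · -- `#range ∣ #(R/H) = [R : H]`
    have h := AddSubgroup.card_addSubgroup_dvd_card φ.range
    rwa [← AddSubgroup.index_eq_card] at h
  · have h := φ.ker.card_mul_index
    rw [AddSubgroup.index_ker, hkercard] at h
    rw [← h, mul_comm]

end Primary

/-! ## §3 Twist-invariance of `2`-torsion counts -/

section Twist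

variable {F : Type*} [Field F] [NeZero (2 : F)] (X : WeierstrassCurve F)

/-- **`ψ_{W^{(d)}}(d x) = d³ ψ_W(x)`**: the `2`-division cubic of the quadratic twist (`b₂ ↦ d b₂`, `b₄ ↦ d² b₄`, `b₆ ↦ d³ b₆`).
[cite: SilvermanAEC2009, X.§5 (quadratic twists) and III.1] -/
theorem eval_twoTorsionPolynomial_quadraticTwist (d x : F) :
    ((X.quadraticTwist d).twoTorsionPolynomial.toPoly.eval (d * x)) = d ^ 3 * X.twoTorsionPolynomial.toPoly.eval x := by
  simp only [twoTorsionPolynomial, Cubic.toPoly, eval_add, eval_mul, eval_C, eval_pow, eval_X,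
    WeierstrassCurve.quadraticTwist_b₂, WeierstrassCurve.quadraticTwist_b₄, WeierstrassCurve.quadraticTwist_b₆]
  ring

/-- **The quadratic twist has as many rational roots of `ψ` as the curve** (`d ≠ 0`; roots correspond under `x ↦ d x`).
[cite: SilvermanAEC2009, X.§5 and III.2.3(d)] -/
theorem ncard_isRoot_twoTorsionPolynomial_quadraticTwist {d : F} (hd : d ≠ 0) :
    {x : F | (X.quadraticTwist d).twoTorsionPolynomial.toPoly.IsRoot x}.ncard =
      {x : F | X.twoTorsionPolynomial.toPoly.IsRoot x}.ncard := by
  have hd3 : d ^ 3 ≠ 0 := pow_ne_zero 3 hd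
  have hset : {x : F | (X.quadraticTwist d).twoTorsionPolynomial.toPoly.IsRoot x} =
      (fun x => d * x) '' {x : F | X.twoTorsionPolynomial.toPoly.IsRoot x} := by
    ext y
    simp only [Set.mem_setOf_eq, Set.mem_image, Polynomial.IsRoot.def]
    constructor
    · intro hy
      refine ⟨y / d, ?_, mul_div_cancel₀ y hd⟩
      have h := eval_twoTorsionPolynomial_quadraticTwist X d (y / d)
      rw [mul_div_cancel₀ y hd, hy] at h
      exact (mul_eq_zero.mp h.symm).resolve_left hd3
    · rintro ⟨x, hx, rfl⟩
      rw [eval_twoTorsionPolynomial_quadraticTwist, hx, mul_zero]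
  rw [hset, Set.ncard_image_of_injective _ (mul_right_injective₀ hd)]

/-- **`#W^{(d)}(F)[2] = #W(F)[2]`** for an elliptic curve over a field with `2 ≠ 0` and `d ≠ 0` (`#·[2] = #roots of ψ + 1`,
tree `WeierstrassCurve.natCard_torsionBy_two_eq`). [cite: SilvermanAEC2009, III.2.3(d) and X.§5] -/
theorem natCard_twoTorsion_quadraticTwist [X.IsElliptic] {d : F} (hd : d ≠ 0) :
    Nat.card {P : (X.quadraticTwist d).toAffine.Point // 2 • P = 0} = Nat.card {P : X.toAffine.Point // 2 • P = 0} := by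
  haveI := X.isElliptic_quadraticTwist hd
  have h2 : (2 : F) ≠ 0 := NeZero.ne 2
  have hsub : ∀ (Y : WeierstrassCurve F), Nat.card {P : Y.toAffine.Point // 2 • P = 0} =
      Nat.card (AddSubgroup.torsionBy Y.toAffine.Point (2 : ℤ)) := fun Y =>
    Nat.card_congr (Equiv.subtypeEquivRight fun Q => by
      rw [Submodule.mem_toAddSubgroup, Submodule.mem_torsionBy_iff, two_zsmul, two_nsmul])
  rw [hsub, hsub, WeierstrassCurve.natCard_torsionBy_two_eq _ h2, WeierstrassCurve.natCard_torsionBy_two_eq _ h2,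
    ncard_isRoot_twoTorsionPolynomial_quadraticTwist X hd]

/-- **A model of a quadratic twist has as many `L`-rational `2`-torsion points as the curve**, for every field `L ⊇ ℚ`:
`Wd = Cd • W^{(d)}` (`d ≠ 0`) ⟹ `#Wd(L)[2] = #W(L)[2]` (the change of variables is a group isomorphism
`VariableChange.pointEquivBaseChange`; base change commutes with the twist, `baseChange_quadraticTwist`).  For `L = ℚ_q`,
`q ∣ d_K`, this identifies the twin side's genus budget `∏ #Wd(ℚ_q)[2]` with `∏ #W(ℚ_q)[2] = 2^{ord₂ C(Wd)}`.
[cite: SilvermanAEC2009, III.3.1(b) and X.§5] -/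
theorem natCard_twoTorsion_baseChange_twin_eq (W Wd : WeierstrassCurve ℚ) [W.IsElliptic] {d : ℚ} (hd : d ≠ 0)
    (Cd : VariableChange ℚ) (hWd : Cd • W.quadraticTwist d = Wd) (L : Type*) [Field L] [CharZero L] [Algebra ℚ L] :
    Nat.card {P : (Wd.baseChange L).toAffine.Point // 2 • P = 0} =
      Nat.card {P : (W.baseChange L).toAffine.Point // 2 • P = 0} := by
  subst hWd
  have e := (VariableChange.pointEquivBaseChange (W.quadraticTwist d) Cd L).symm
  rw [TowerLayer.natCard_twoTorsion_congr e, baseChange_quadraticTwist W L d]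
  have hdL : algebraMap ℚ L d ≠ 0 := by
    rw [ne_eq, map_eq_zero_iff _ (algebraMap ℚ L).injective]
    exact hd
  haveI : NeZero (2 : L) := ⟨by exact_mod_cast (Nat.succ_ne_zero 1)⟩
  exact natCard_twoTorsion_quadraticTwist (W.baseChange L) hdL

end Twist

end Summit.BirchSwinnertonDyer.BirchSwinnertonDyer.Theorems.GenusExact.PlusDescent

end
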